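import Summits.NavierStokesRegularity.FluidComputer.GateBudgetPulseWindow
import HarnessLib

/-!
# What no tuning can beat, part 56: THE COLD-PHASE BRACKET LAWS — the two-sided local laws the
# misfire ladder's cold half needs: the output pair moves by at most `2Rc₁(t - T)` while the
# trigger is `≤ c₁`; the carrier is bracketed `1 - P₀ - δ - η ≤ a² ≤ 1 - P₀ + δ` by the pair
# and the trigger pair; the clock's increments are bracketed `(εα⁻ - μc₁²)(t - s) ≤ b(t) - b(s)
# ≤ εα⁺(t - s)` by the carrier bracket; and the trigger REMEMBERS the clock's action
# two-sidedly, `c(s)e^{μ(B(t) - B(s))} ≤ c(t) ≤ (c(s) + σE(t - s))e^{μ(B(t) - B(s))}` (`B' = b`)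

Cell `pub-fluidc`, blueprint seat bp1 (gen 34, sixth item); same namespace and conventions as
parts 1–55 (`GateBudget*.lean`); imports part 18 (`GateBudgetPulseWindow`: `knob_trigger_pos`)
only — independent of parts 48–55. General five-gate circuit `fiveGateCircuit ε σ μ R K`
(modes `0 = a` carrier, `1 = b` clock, `2 = c` trigger, `3 = d`, `4 = ã`; `ḃ = εa² - μc²`,
`ċ = σa² + μbc`, `∂ₜ(d² + ã²) = 2Rcad` — part 1's `out_energy`) and the knob family
`rotorCircuit K M ε ρ` (`σ = ρ²e^{-M}`, `μ = ε⁻¹M`, `R = ρ⁻²`). HONEST FRAMING (verbatim):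
low prior, high value-of-information experiment on Tao's machine paradigm; NOT a claim that NS
blows up. Nothing is proved about the Navier–Stokes equations.

THE POINT (SPEC-INPUT-bp1 §AZ, the θ-DRIFT AUDIT of the ladder (20′d′)). The cold half of a
rung (dousing `T′` → clock zero `tz` → relight `r′`) was certified for pulses 2 and 3 by ONE-SIDED
laws with frozen constants (parts 37/39/44/47: clock rate `≥ 0.983ε` from the pair bound
`a² ≥ α₋ = 0.983`, cold window `≥ 2θ′` from `a² ≤ 1`, relight `< tz + 1.43`). Composed, those
laws map the dousing clock `-θ′ε` (θ′ ≈ θ_n) to `θ_{n+1} ≥ 0.983(2θ′ - θ′/0.983) = 0.966θ′`: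
`1.394 → 1.347 → 1.301 → 1.257 < 1.265` — the induction hypothesis `b(r_n) ∈ [1.265ε, 1.44ε]`
dies within three rungs, an ARTEFACT of bounding the clock's rise with `a² ≥ α₋` and the debt's
repayment with `a² ≤ 1` separately (the factor `0.966 = 1 - 2(1 - α₋)` is the width of the
absolute bracket). The exact cold phase uses ONE function `A(t) = ∫_{T′}^t a²`: `b = b(T′) + εA -
μ∫c²`, `log c = log c(T′) + μ∫b + ∫σa²/c`; with `a²` bracketed `α_n ± δ_n` on the cold phase
(`α_n = 1 - P(T′)` rung data, `δ_n = O(K⁻⁹)`: the pair is frozen while `c ≤ ρ²/K⁹`, §166, and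
`b² + c² = O(ε²)`) the rung map is `θ_{n+1} = θ′(1 ± 4.1δ_n/α_n) + O(log K/K¹⁰)` in the debt
branch (and clipped to `√(2α_n) ∈ [1.4023, 1.4143]` in the seed branch) — summable over the
`≈ 10⁻⁴K⁸` rungs of the ladder (total drift `≤ 0.09/K`). This part supplies the four LOCAL
two-sided bricks of that analysis, each over an arbitrary window, no absolute time anywhere:
* §166 `pair_dose_of_le` / `pair_dose` / `knob_pair_dose` — `|P(t) - P(T)| ≤ 2Rc₁d₁(t - T)` on
  `[T, T']` if `c ≤ c₁`, `|d| ≤ d₁` there (`P = d² + ã²`; `|2Rcad| ≤ 2Rc₁d₁` by `|a| ≤ 1`, `c ≥ 0`;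
  crude form `d₁ = 1`).
* §167 `carrier_bracket` — `|P(t) - P₀| ≤ δ`, `b² + c² ≤ η` ⇒ `1 - P₀ - δ - η ≤ a² ≤ 1 - P₀ + δ`
  (the energy identity `a² + b² + c² + d² + ã² = 1`).
* §168 `clock_bracket` — `α⁻ ≤ a² ≤ α⁺` and `c² ≤ c₁²` on `[T, T']` ⇒ for `T ≤ s ≤ t ≤ T'`:
  `(εα⁻ - μc₁²)(t - s) ≤ b(t) - b(s) ≤ εα⁺(t - s)` (`ḃ = εa² - μc²`, mean value).
* §169 `exists_clock_action`, `trigger_memory`, `knob_trigger_memory` — an action `B` (`B' = b`)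
  exists; if `c > 0` on `[s, u]` then `c(s)e^{μ(B(t) - B(s))} ≤ c(t)` for `t ∈ [s, u]`
  (`(log c - μB)' = σa²/c ≥ 0`); knob family: automatic from `c(s) > 0`, `s ≥ 0` (part 18).
* §170 `trigger_debt` — if `e^{-μ(B(τ) - B(s))} ≤ E` on `[s, u]` then `c(t) ≤ (c(s) + σE(t -
  s))e^{μ(B(t) - B(s))}` (`(ce^{-μ(B - B(s))})' = σa²e^{-μ(B - B(s))} ≤ σE`): part 31's clock-debt
  law with the explicit quadratic clock bound replaced by ANY action `B`.

READING. §168 with a COMMON bracket for rise and repayment is what makes the cold half of the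
rung map `θ ↦ θ(1 ± O(δ))` instead of `θ ↦ 0.966θ`; §169/§170 turn the clock's
action into two-sided trigger levels (cold window from below AND relight from above with the same
`B`); §166/§167 discharge the bracket from the frozen pair. The laws 3″/4″/5″ of the cold half
(SPEC-INPUT-bp1 §AZ) are these bricks instantiated on `[T′, tz]`, `[tz, r′]` with `c₁ = ρ²/K⁹`,
`d₁ = √(1/60 + 5/K¹⁰)`, `δ = 2c₁d₁(t - T′)/ρ² ≤ 0.78/K⁹`, `η = 3ε²`.
HONEST LIMITS. (i) Bricks, not the laws: the instantiation (hitting times `tz`, `r′`, the seed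
branch `θ² > 2α`, the numerics `δ`, `η`, `E`) is the successor's; (ii) §169/§170 take the action
`B` as data (`exists_clock_action` provides one; any two differ by a constant, which cancels);
(iii) §166 needs `R ≥ 0`, `σ ≥ 0`, `T ≥ 0` (trigger non-negative); §168 needs `ε, μ ≥ 0`;
§170 needs the trajectory from (5.6) (`a² ≤ 1`); (iv) nothing about Navier–Stokes.
[cite: Tao2016AveragedNS, §5.5 Theorem 5.3, (5.5), (5.6), (b-eq), (c-eq), (energy-con)]
-/

noncomputable section

namespace Summit.NavierStokesRegularity.FluidComputer.GateBudget

open Real Set Filter Topology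
open Literature.Analysis.FluidPDE.Tao2016AveragedNS

section Bricks

variable {ε σ μ R K : ℝ} {X : ℝ → Fin 5 → ℝ}

/-! ## §166 The output pair is frozen while the trigger is small -/

/-- **PAIR DOSE.** Along `fiveGateCircuit ε σ μ R K` from (5.6) (`σ ≥ 0`, `R ≥ 0`): if `c ≤ c₁`
and `|d| ≤ d₁` on `[T, T']` (`T ≥ 0`) then `|d(t)² + ã(t)² - (d(T)² + ã(T)²)| ≤ 2Rc₁d₁(t - T)`
for `t ∈ [T, T']` (`∂ₜ(d² + ã²) = 2Rcad`, `|a| ≤ 1`, `c ≥ 0`).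
[cite: Tao2016AveragedNS, §5.5 (5.5), (est)] -/
theorem pair_dose_of_le (hX : ∀ t, HasDerivAt X (fiveGateCircuit ε σ μ R K (X t)) t)
    (h0 : X 0 = delayInit) (hσ : 0 ≤ σ) (hR : 0 ≤ R) {T T' c₁ d₁ : ℝ} (hT : 0 ≤ T)
    (hc : ∀ t ∈ Icc T T', X t 2 ≤ c₁) (hd : ∀ t ∈ Icc T T', |X t 3| ≤ d₁) {t : ℝ}
    (ht : t ∈ Icc T T') :
    |X t 3 ^ 2 + X t 4 ^ 2 - (X T 3 ^ 2 + X T 4 ^ 2)| ≤ 2 * R * c₁ * d₁ * (t - T) := by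
  have hP : ∀ r, HasDerivAt (fun s => X s 3 ^ 2 + X s 4 ^ 2) (2 * R * X r 2 * X r 0 * X r 3) r :=
    fun r => out_energy (hX r)
  have hdiff : Differentiable ℝ fun s => X s 3 ^ 2 + X s 4 ^ 2 := fun r => (hP r).differentiableAt
  have hd1 : 0 ≤ d₁ := (abs_nonneg _).trans (hd t ht)
  have hbd : ∀ r ∈ Icc T t, |2 * R * X r 2 * X r 0 * X r 3| ≤ 2 * R * c₁ * d₁ := by
    intro r hr
    have hrI : r ∈ Icc T T' := ⟨hr.1, hr.2.trans ht.2⟩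
    have hc0 : 0 ≤ X r 2 := c_nonneg hX h0 hσ (hT.trans hr.1)
    have h1 : |X r 0| * |X r 3| ≤ 1 * d₁ :=
      mul_le_mul (traj_abs_le_one hX h0 r 0) (hd r hrI) (abs_nonneg _) zero_le_one
    have h2 : |2 * R * X r 2 * X r 0 * X r 3| = 2 * R * X r 2 * (|X r 0| * |X r 3|) := by
      rw [abs_mul, abs_mul, abs_of_nonneg (by positivity : (0 : ℝ) ≤ 2 * R * X r 2)]; ring
    rw [h2]
    have h3 : 2 * R * X r 2 * (|X r 0| * |X r 3|) ≤ 2 * R * X r 2 * (1 * d₁) :=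
      mul_le_mul_of_nonneg_left h1 (by positivity)
    have h4 : 2 * R * X r 2 * d₁ ≤ 2 * R * c₁ * d₁ :=
      mul_le_mul_of_nonneg_right (mul_le_mul_of_nonneg_left (hc r hrI) (by positivity)) hd1
    linarith only [h3, h4]
  have hup := (convex_Icc T t).image_sub_le_mul_sub_of_deriv_le hdiff.continuous.continuousOn
    hdiff.differentiableOn (C := 2 * R * c₁ * d₁)
    (fun r hr => by rw [(hP r).deriv]; exact (le_abs_self _).trans (hbd r (interior_subset hr)))
    T (left_mem_Icc.2 ht.1) t (right_mem_Icc.2 ht.1) ht.1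
  have hlo := (convex_Icc T t).mul_sub_le_image_sub_of_le_deriv hdiff.continuous.continuousOn
    hdiff.differentiableOn (C := -(2 * R * c₁ * d₁))
    (fun r hr => by rw [(hP r).deriv]; exact (neg_le.1 (neg_le_abs _ |>.trans
      (hbd r (interior_subset hr)))))
    T (left_mem_Icc.2 ht.1) t (right_mem_Icc.2 ht.1) ht.1
  exact abs_le.2 ⟨by linarith only [hlo], hup⟩

/-- **PAIR DOSE, crude form** (`|d| ≤ 1`): `c ≤ c₁` on `[T, T']` (`T ≥ 0`) gives
`|d(t)² + ã(t)² - (d(T)² + ã(T)²)| ≤ 2Rc₁(t - T)`. [cite: Tao2016AveragedNS, §5.5 (5.5), (est)] -/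
theorem pair_dose (hX : ∀ t, HasDerivAt X (fiveGateCircuit ε σ μ R K (X t)) t)
    (h0 : X 0 = delayInit) (hσ : 0 ≤ σ) (hR : 0 ≤ R) {T T' c₁ : ℝ} (hT : 0 ≤ T)
    (hc : ∀ t ∈ Icc T T', X t 2 ≤ c₁) {t : ℝ} (ht : t ∈ Icc T T') :
    |X t 3 ^ 2 + X t 4 ^ 2 - (X T 3 ^ 2 + X T 4 ^ 2)| ≤ 2 * R * c₁ * (t - T) := by
  have h := pair_dose_of_le hX h0 hσ hR hT hc (fun r _ => traj_abs_le_one hX h0 r 3) ht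
  simpa only [mul_one] using h

/-! ## §168 The clock's increments are bracketed by the carrier bracket -/

/-- **CLOCK BRACKET.** Along `fiveGateCircuit ε σ μ R K` (`ε, μ ≥ 0`): if `α⁻ ≤ a² ≤ α⁺` and
`c² ≤ c₁²` on `[T, T']` then `(εα⁻ - μc₁²)(t - s) ≤ b(t) - b(s) ≤ εα⁺(t - s)` for
`T ≤ s ≤ t ≤ T'` (`ḃ = εa² - μc²`). [cite: Tao2016AveragedNS, §5.5 (b-eq)] -/
theorem clock_bracket (hX : ∀ t, HasDerivAt X (fiveGateCircuit ε σ μ R K (X t)) t) (hε : 0 ≤ ε)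
    (hμ : 0 ≤ μ) {T T' αl αu c₁ : ℝ} (ha : ∀ t ∈ Icc T T', αl ≤ X t 0 ^ 2 ∧ X t 0 ^ 2 ≤ αu)
    (hc : ∀ t ∈ Icc T T', X t 2 ^ 2 ≤ c₁ ^ 2) {s t : ℝ} (hs : s ∈ Icc T T') (ht : t ∈ Icc T T')
    (hst : s ≤ t) :
    (ε * αl - μ * c₁ ^ 2) * (t - s) ≤ X t 1 - X s 1 ∧ X t 1 - X s 1 ≤ ε * αu * (t - s) := by
  have hd := hasDerivAt_b hX
  have hdiff : Differentiable ℝ fun r => X r 1 := fun r => (hd r).differentiableAt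
  have hin : ∀ r ∈ interior (Icc s t), r ∈ Icc T T' := fun r hr =>
    ⟨hs.1.trans (interior_subset hr).1, (interior_subset hr).2.trans ht.2⟩
  constructor
  · refine (convex_Icc s t).mul_sub_le_image_sub_of_le_deriv hdiff.continuous.continuousOn
      hdiff.differentiableOn (fun r hr => ?_) s (left_mem_Icc.2 hst) t (right_mem_Icc.2 hst) hst
    rw [(hd r).deriv]
    have h1 := mul_le_mul_of_nonneg_left (ha r (hin r hr)).1 hε
    have h2 := mul_le_mul_of_nonneg_left (hc r (hin r hr)) hμ
    linarith only [h1, h2]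
  · refine (convex_Icc s t).image_sub_le_mul_sub_of_deriv_le hdiff.continuous.continuousOn
      hdiff.differentiableOn (fun r hr => ?_) s (left_mem_Icc.2 hst) t (right_mem_Icc.2 hst) hst
    rw [(hd r).deriv]
    have h1 := mul_le_mul_of_nonneg_left (ha r (hin r hr)).2 hε
    have h2 := mul_nonneg hμ (sq_nonneg (X r 2))
    linarith only [h1, h2]

/-! ## §169 The trigger remembers the clock's action: the lower law -/

/-- A clock ACTION exists: `B(t) = ∫₀ᵗ b` has `B' = b`. [folklore] -/
theorem exists_clock_action (hX : ∀ t, HasDerivAt X (fiveGateCircuit ε σ μ R K (X t)) t) :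
    ∃ B : ℝ → ℝ, ∀ t, HasDerivAt B (X t 1) t :=
  ⟨fun s => ∫ r in (0 : ℝ)..s, X r 1, fun s =>
    ((continuous_traj hX 1).integral_hasStrictDerivAt 0 s).hasDerivAt⟩

/-- **TRIGGER MEMORY (lower law).** Along `fiveGateCircuit ε σ μ R K` (`σ ≥ 0`), with any action
`B` (`B' = b`): if `c > 0` on `[s, u]` then `c(s)e^{μ(B(t) - B(s))} ≤ c(t)` for `t ∈ [s, u]` —
`(log c - μB)' = σa²/c ≥ 0`. [cite: Tao2016AveragedNS, §5.5 (c-eq)] -/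
theorem trigger_memory (hX : ∀ t, HasDerivAt X (fiveGateCircuit ε σ μ R K (X t)) t) (hσ : 0 ≤ σ)
    {B : ℝ → ℝ} (hB : ∀ t, HasDerivAt B (X t 1) t) {s u : ℝ} (hpos : ∀ t ∈ Icc s u, 0 < X t 2)
    {t : ℝ} (ht : t ∈ Icc s u) : X s 2 * exp (μ * (B t - B s)) ≤ X t 2 := by
  have hg : ∀ r ∈ Icc s u, HasDerivAt (fun r => log (X r 2) - μ * B r)
      ((σ * X r 0 ^ 2 + μ * X r 1 * X r 2) / X r 2 - μ * X r 1) r := fun r hr =>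
    ((hasDerivAt_c hX r).log (hpos r hr).ne').sub ((hB r).const_mul μ)
  have hmono : MonotoneOn (fun r => log (X r 2) - μ * B r) (Icc s u) := by
    refine monotoneOn_of_deriv_nonneg (convex_Icc s u)
      (fun r hr => (hg r hr).continuousAt.continuousWithinAt)
      (fun r hr => (hg r (interior_subset hr)).differentiableAt.differentiableWithinAt)
      fun r hr => ?_
    have hr' := interior_subset hr
    have hc := hpos r hr'
    rw [(hg r hr').deriv, show (σ * X r 0 ^ 2 + μ * X r 1 * X r 2) / X r 2 - μ * X r 1
      = σ * X r 0 ^ 2 / X r 2 by field_simp; ring]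
    positivity
  have h1 := hmono (left_mem_Icc.2 (ht.1.trans ht.2)) ht ht.1
  simp only at h1
  have h2 : log (X s 2) + μ * (B t - B s) ≤ log (X t 2) := by linarith only [h1]
  calc X s 2 * exp (μ * (B t - B s)) = exp (log (X s 2) + μ * (B t - B s)) := by
        rw [Real.exp_add, Real.exp_log (hpos s (left_mem_Icc.2 (ht.1.trans ht.2)))]
    _ ≤ exp (log (X t 2)) := Real.exp_le_exp.2 h2
    _ = X t 2 := Real.exp_log (hpos t ht)

/-! ## §170 The trigger's debt against any action: the upper law -/

/-- **TRIGGER DEBT (upper law).** Along `fiveGateCircuit ε σ μ R K` from (5.6) (`σ ≥ 0`), with any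
action `B` (`B' = b`): if `e^{-μ(B(τ) - B(s))} ≤ E` for `τ ∈ [s, u]` then
`c(t) ≤ (c(s) + σE(t - s))e^{μ(B(t) - B(s))}` for `t ∈ [s, u]` (`(ce^{-μ(B - B(s))})' =
σa²e^{-μ(B - B(s))} ≤ σE`). [cite: Tao2016AveragedNS, §5.5 (c-eq), (est)] -/
theorem trigger_debt (hX : ∀ t, HasDerivAt X (fiveGateCircuit ε σ μ R K (X t)) t)
    (h0 : X 0 = delayInit) (hσ : 0 ≤ σ) {B : ℝ → ℝ} (hB : ∀ t, HasDerivAt B (X t 1) t)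
    {s u E : ℝ} (hE : ∀ τ ∈ Icc s u, exp (-(μ * (B τ - B s))) ≤ E) {t : ℝ} (ht : t ∈ Icc s u) :
    X t 2 ≤ (X s 2 + σ * E * (t - s)) * exp (μ * (B t - B s)) := by
  have hw : ∀ r, HasDerivAt (fun r => -(μ * (B r - B s))) (-(μ * X r 1)) r := fun r =>
    (((hB r).sub_const (B s)).const_mul μ).neg
  have hh : ∀ r, HasDerivAt (fun r => X r 2 * exp (-(μ * (B r - B s))))
      ((σ * X r 0 ^ 2 + μ * X r 1 * X r 2) * exp (-(μ * (B r - B s)))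
        + X r 2 * (exp (-(μ * (B r - B s))) * -(μ * X r 1))) r := fun r =>
    (hasDerivAt_c hX r).mul (hw r).exp
  have hdiff : Differentiable ℝ fun r => X r 2 * exp (-(μ * (B r - B s))) := fun r =>
    (hh r).differentiableAt
  have hup := (convex_Icc s t).image_sub_le_mul_sub_of_deriv_le hdiff.continuous.continuousOn
    hdiff.differentiableOn (C := σ * E) (fun r hr => by
      have hr' : r ∈ Icc s u := ⟨(interior_subset hr).1, (interior_subset hr).2.trans ht.2⟩
      rw [(hh r).deriv, show (σ * X r 0 ^ 2 + μ * X r 1 * X r 2) * exp (-(μ * (B r - B s)))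
        + X r 2 * (exp (-(μ * (B r - B s))) * -(μ * X r 1))
        = σ * (X r 0 ^ 2 * exp (-(μ * (B r - B s)))) by ring]
      have h1 : X r 0 ^ 2 * exp (-(μ * (B r - B s))) ≤ 1 * E :=
        mul_le_mul (traj_sq_le_one hX h0 r 0) (hE r hr') (exp_pos _).le zero_le_one
      have h2 := mul_le_mul_of_nonneg_left h1 hσ
      linarith only [h2])
    s (left_mem_Icc.2 ht.1) t (right_mem_Icc.2 ht.1) ht.1
  simp only [sub_self, mul_zero, neg_zero, Real.exp_zero, mul_one] at hup
  have h3 : X t 2 * exp (-(μ * (B t - B s))) ≤ X s 2 + σ * E * (t - s) := by linarith only [hup]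
  calc X t 2 = X t 2 * exp (-(μ * (B t - B s))) * exp (μ * (B t - B s)) := by
        rw [mul_assoc, ← Real.exp_add, neg_add_cancel, Real.exp_zero, mul_one]
    _ ≤ (X s 2 + σ * E * (t - s)) * exp (μ * (B t - B s)) :=
        mul_le_mul_of_nonneg_right h3 (exp_pos _).le

end Bricks

/-! ## §167 The carrier bracket, and the knob-family forms -/

variable {K M ε ρ : ℝ} {X : ℝ → Fin 5 → ℝ}

/-- **CARRIER BRACKET.** Along `rotorCircuit K M ε ρ` from (5.6): `|d² + ã² - P₀| ≤ δ` and
`b² + c² ≤ η` at time `t` give `1 - P₀ - δ - η ≤ a(t)² ≤ 1 - P₀ + δ` (the energy identity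
`a² + b² + c² + d² + ã² = 1`). [cite: Tao2016AveragedNS, §5.5 (energy-con)] -/
theorem carrier_bracket (hX : ∀ t, HasDerivAt X (RotorKnob.rotorCircuit K M ε ρ (X t)) t)
    (h0 : X 0 = delayInit) {t P₀ δ η : ℝ} (hP : |X t 3 ^ 2 + X t 4 ^ 2 - P₀| ≤ δ)
    (hη : X t 1 ^ 2 + X t 2 ^ 2 ≤ η) :
    1 - P₀ - δ - η ≤ X t 0 ^ 2 ∧ X t 0 ^ 2 ≤ 1 - P₀ + δ := by
  have h1 := RotorKnob.traj_sum_sq_eq_one hX h0 t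
  obtain ⟨hl, hu⟩ := abs_le.1 hP
  exact ⟨by linarith only [h1, hu, hη],
    by linarith only [h1, hl, sq_nonneg (X t 1), sq_nonneg (X t 2)]⟩

/-- **TRIGGER MEMORY, knob family.** Along `rotorCircuit K M ε ρ` from (5.6) (`0 < ε`, `0 ≤ M`),
with any action `B` (`B' = b`): `c(s) > 0` at `s ≥ 0` gives `c(s)e^{ε⁻¹M(B(t) - B(s))} ≤ c(t)`
for all `t ≥ s` (part 18's `knob_trigger_pos` supplies `c > 0` on `[s, t]`).
[cite: Tao2016AveragedNS, §5.5 (c-eq)] -/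
theorem knob_trigger_memory (hX : ∀ t, HasDerivAt X (RotorKnob.rotorCircuit K M ε ρ (X t)) t)
    (h0 : X 0 = delayInit) (hε : 0 < ε) (hM : 0 ≤ M) {B : ℝ → ℝ}
    (hB : ∀ t, HasDerivAt B (X t 1) t) {s t : ℝ} (hs : 0 ≤ s) (hst : s ≤ t) (hcs : 0 < X s 2) :
    X s 2 * exp (ε⁻¹ * M * (B t - B s)) ≤ X t 2 := by
  have hpos : ∀ r ∈ Icc s t, 0 < X r 2 := fun r hr => knob_trigger_pos hX h0 hε hM hs hr.1 hcs
  have hXf := hX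
  rw [RotorKnob.rotorCircuit_eq_fiveGate] at hXf
  exact trigger_memory hXf (by positivity) hB hpos (right_mem_Icc.2 hst)

/-- **PAIR DOSE, knob family.** Along `rotorCircuit K M ε ρ` from (5.6): if `c ≤ c₁` and
`|d| ≤ d₁` on `[T, T']` (`T ≥ 0`) then `|d(t)² + ã(t)² - (d(T)² + ã(T)²)| ≤ 2c₁d₁(t - T)/ρ²` for
`t ∈ [T, T']` (`R = ρ⁻²`); with `c₁ = ρ²/K⁹`, `d₁ = 1` the cold phase moves the pair by at most
`2(t - T)/K⁹` (and by `≤ 2√P₊(t - T)/K⁹` with the pair bound `d² ≤ P₊`).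
[cite: Tao2016AveragedNS, §5.5 (5.5), (est)] -/
theorem knob_pair_dose (hX : ∀ t, HasDerivAt X (RotorKnob.rotorCircuit K M ε ρ (X t)) t)
    (h0 : X 0 = delayInit) {T T' c₁ d₁ : ℝ} (hT : 0 ≤ T) (hc : ∀ t ∈ Icc T T', X t 2 ≤ c₁)
    (hd : ∀ t ∈ Icc T T', |X t 3| ≤ d₁) {t : ℝ} (ht : t ∈ Icc T T') :
    |X t 3 ^ 2 + X t 4 ^ 2 - (X T 3 ^ 2 + X T 4 ^ 2)| ≤ 2 * (ρ ^ 2)⁻¹ * c₁ * d₁ * (t - T) := by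
  have hXf := hX
  rw [RotorKnob.rotorCircuit_eq_fiveGate] at hXf
  exact pair_dose_of_le hXf h0 (by positivity) (by positivity) hT hc hd ht

end Summit.NavierStokesRegularity.FluidComputer.GateBudget
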